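import Summits.QuantumFields.YangMills.Theses.SwapVirialDeficit
import Summits.QuantumFields.YangMills.Theses.VirialFluxGap
import Summits.QuantumFields.YangMills.Theorems.SwapVirialDeficitRingTraceSmooth
import Summits.QuantumFields.YangMills.Theorems.SwapVirialDeficitLogTwistTraceConvex
import Summits.QuantumFields.YangMills.Theorems.VirialFluxGapConvexTransport
import Summits.QuantumFields.YangMills.Theorems.SwapVirialDeficitWindowArithmeticSigma
import HarnessLib

/-!
# Route `SwapVirialDeficit` (YangMills): the sharp σ-glued Laplace law implies `SwapGluedStiffness` — LINE «sharp-sigma» composed in the tree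
# (crux ⟨stmt-QuantumFields-24197⟩ `SwapVirialDeficit.SwapGluedStiffness`; planner ym-idea-4 g14, skeleton `bc/g14-B/sigma/SwapGluedStiffness_sharp_birth.lean`)

The skeleton LINE «sharp-sigma» composes the crux `SwapGluedStiffness` (by name, `c := 1/4`) from four stubs, three of which are theorems
of the tree: ✓`TT.SectorSmooth.logTwistTraceConvex` (`stub_logTwistTraceConvex`), ✓`VirialFluxGap.ConvexTransport.convexTransport_proof`
(`stub_convexTransport` = item 24181) and ✓`SharpSigma.windowArithmeticSigma` (`stub_windowArithmeticSigma`); differentiability and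
positivity of `Z^S` are the landed ✓`swapVirialDeficit_ringTraceSmooth_proof` (item 24135).  This file lands the composition with those three
discharged, so that IN THE TREE the crux ⟨24197⟩ rests on ONE analytic statement, the heart `SharpSwapLaplace` (stated here verbatim from the
skeleton as the hypothesis `hSharp`; no `def`):

★★ `swapGluedStiffness_of_sharpSwapLaplace : (∃ a > 0, K > 0, q ≥ 0, θ ∈ (0,1], C(L), β₀, L₀: ∀ b ≥ β₀, L₀ ≤ L ≤ b^a,
  |log Z^S(L,b,2L) − (12bL⁴ − (9L⁴−1)·log b + C L)| ≤ K·L^q·b^{−θ}) → Theses.SwapVirialDeficit.SwapGluedStiffness`.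

The proof is the planner's kernel-checked `SwapGluedStiffness_of` (convex transport of `f = log Z^S − 12L⁴x` against the model
`−(D/2)log x + C`, `D = 18L⁴ − 2`, on `[β/2, 2β]`; `8√(ηD) ≤ 1/4` on the window).  The companion file
`…SharpSwapLaplaceOfVolumeLaw.lean` reduces the heart further to a sharp small-ball law of the σ-glued ring (exponent `9L⁴ − 1`, no log).
HONEST FRAMING: conditional bookkeeping on the OPEN heart `SharpSwapLaplace`; ⟨24197⟩, ⟨24194⟩ and every rung / summit statement stay OPEN;
the Yang–Mills mass gap is NOT proved; no summit is proved by a line.  THEOREMS ONLY (0 `def`, 0 `sorry`), standard axioms.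
Seat ym-line-fcl-p3 g43 (cell ym-idea-1, free hands), `--supports stmt-QuantumFields-24197`.
References: [cite: Griffiths1964]; [cite: tHooft1979]; [cite: MontvayMunster1994, (3.145)].
-/

set_option autoImplicit false

noncomputable section

open Set

namespace Summit.QuantumFields.YangMills.Theorems.SwapVirialDeficit.SharpSigma

open Summit.QuantumFields.YangMills.Theorems.FemtoTransferGap

/-- ★★ **LINE «sharp-sigma» composed: the sharp two-sided Laplace law of the σ-glued ring trace gives `SwapGluedStiffness` with `c = 1/4`.**
Hypothesis `hSharp` = the skeleton's `SharpSwapLaplace` verbatim; the other three stubs and `RingTraceSmooth` are discharged by the tree.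
[cite: Griffiths1964] [cite: tHooft1979] -/
theorem swapGluedStiffness_of_sharpSwapLaplace
    (hSharp : ∃ a : ℝ, 0 < a ∧ ∃ K : ℝ, 0 < K ∧ ∃ q : ℝ, 0 ≤ q ∧ ∃ θ : ℝ, 0 < θ ∧ θ ≤ 1 ∧ ∃ C : ℕ → ℝ, ∃ β₀ : ℝ, ∃ L₀ : ℕ,
      ∀ b : ℝ, β₀ ≤ b → ∀ (L : ℕ) [NeZero L], L₀ ≤ L → (L : ℝ) ≤ b ^ a →
        |Real.log (TT.twistTrace L b (2 * L)) - (12 * b * (L : ℝ) ^ 4 - (9 * (L : ℝ) ^ 4 - 1) * Real.log b + C L)| ≤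
          K * (L : ℝ) ^ q * b ^ (-θ)) :
    Summit.QuantumFields.YangMills.Theses.SwapVirialDeficit.SwapGluedStiffness := by
  obtain ⟨a, ha, K, hK, q, hq, θ, hθ, hθ1, C, β₀, L₀, hS⟩ := hSharp
  obtain ⟨a', ha', β₁, hW⟩ := windowArithmeticSigma a K q θ β₀ ha hK hq hθ hθ1
  have hCT := Summit.QuantumFields.YangMills.Theorems.VirialFluxGap.ConvexTransport.convexTransport_proof
  refine ⟨a', ha', 1 / 4, by norm_num, β₁, max L₀ 1, ?_⟩
  intro β hβ L _ hL hLwin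
  have hL₀ : L₀ ≤ L := le_trans (le_max_left _ _) hL
  have hL1 : 1 ≤ L := le_trans (le_max_right _ _) hL
  have hL1r : (1 : ℝ) ≤ (L : ℝ) := by exact_mod_cast hL1
  obtain ⟨hβpos, hβ₀, hx, hηD, hsqrt⟩ := hW β hβ L hL1 hLwin
  obtain ⟨_, hdiff, hpos⟩ := Summit.QuantumFields.YangMills.Theorems.swapVirialDeficit_ringTraceSmooth_proof L (2 * L)
  -- the convex function to transport
  set D : ℝ := 18 * (L : ℝ) ^ 4 - 2 with hD
  set η : ℝ := K * (L : ℝ) ^ q * (β / 2) ^ (-θ) with hη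
  have hDpos : 0 < D := by
    have h4 : (1 : ℝ) ≤ (L : ℝ) ^ 4 := one_le_pow₀ hL1r
    rw [hD]; linarith
  have hηnn : 0 ≤ η := by
    rw [hη]
    have : 0 ≤ (β / 2) ^ (-θ) := Real.rpow_nonneg (by linarith) _
    positivity
  set f : ℝ → ℝ := fun x => Real.log (TT.twistTrace L x (2 * L)) - 12 * (L : ℝ) ^ 4 * x with hf
  -- convexity
  have hlin : ConvexOn ℝ Set.univ (fun x : ℝ => -(12 * (L : ℝ) ^ 4 * x)) := by
    refine ⟨convex_univ, ?_⟩
    intro x _ y _ s t _ _ _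
    simp only [smul_eq_mul]
    exact le_of_eq (by ring)
  have hconv_univ : ConvexOn ℝ Set.univ f := by
    have h := (TT.SectorSmooth.logTwistTraceConvex L (2 * L)).add hlin
    refine (h.congr ?_).subset (Set.subset_univ _) convex_univ
    intro x _
    simp only [hf, Pi.add_apply]
    ring
  have hconv : ConvexOn ℝ (Set.Icc (β / 2) (2 * β)) f := hconv_univ.subset (Set.subset_univ _) (convex_Icc _ _)
  -- differentiability at `β`
  have hdlog : DifferentiableAt ℝ (fun x : ℝ => Real.log (TT.twistTrace L x (2 * L))) β :=
    (hdiff β).log (ne_of_gt (hpos β).2)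
  have hdlin : HasDerivAt (fun x : ℝ => 12 * (L : ℝ) ^ 4 * x) (12 * (L : ℝ) ^ 4) β := by
    simpa using (hasDerivAt_id β).const_mul (12 * (L : ℝ) ^ 4)
  have hfd : HasDerivAt f (deriv (fun x : ℝ => Real.log (TT.twistTrace L x (2 * L))) β - 12 * (L : ℝ) ^ 4) β :=
    hdlog.hasDerivAt.sub hdlin
  have hdiffAt : DifferentiableAt ℝ f β := hfd.differentiableAt
  have hderiv : deriv f β = deriv (fun x : ℝ => Real.log (TT.twistTrace L x (2 * L))) β - 12 * (L : ℝ) ^ 4 := hfd.deriv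
  -- the two-sided bound on `[β/2, 2β]`
  have hbound : ∀ x ∈ Set.Icc (β / 2) (2 * β), |f x + D / 2 * Real.log x - C L| ≤ η := by
    intro x hxI
    have hx1 : β / 2 ≤ x := hxI.1
    obtain ⟨hLx, hxθ⟩ := hx x hx1
    have hxβ₀ : β₀ ≤ x := le_trans hβ₀ hx1
    have hSx := hS x hxβ₀ L hL₀ hLx
    have hrew : f x + D / 2 * Real.log x - C L =
        Real.log (TT.twistTrace L x (2 * L)) - (12 * x * (L : ℝ) ^ 4 - (9 * (L : ℝ) ^ 4 - 1) * Real.log x + C L) := by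
      simp only [hf, hD]; ring
    rw [hrew]
    refine le_trans hSx ?_
    rw [hη]
    have hKL : 0 ≤ K * (L : ℝ) ^ q := by positivity
    exact mul_le_mul_of_nonneg_left hxθ hKL
  -- transport
  have hT := hCT f D (C L) η β hβpos hDpos hηnn hηD hconv hdiffAt hbound
  have hT' : β * deriv f β + D / 2 ≤ 1 / 4 := le_trans (le_abs_self _) (le_trans hT hsqrt)
  rw [hderiv, hD] at hT'
  nlinarith [hT']

end Summit.QuantumFields.YangMills.Theorems.SwapVirialDeficit.SharpSigma

end
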